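import Literature.NumberTheory.Sieve.ParityWalshCube
import HarnessLib

/-!
# Walsh polynomials of the parity vector: assembling a tensor law from its coordinate sections

The combinatorial core of the passage "one-parameter parity law for every coordinate section ⟹
parity-vector (Walsh) law for the joint cell tensor" (the bookkeeping behind Bombieri's parity
vectors for several sifted coordinates). Setting: a non-negative tensor `C(j)`,
`j ∈ [1,u]^{n+1}` (cell counts), model weights `a_m ≥ 0` with `a_u = 0` (top cell),
`a_m ≥ a₋ > 0` on the bulk `1 ≤ m < u` and `a_m ≤ a₊`, a mass `M ≥ 0`, and for every coordinate
`i` and frozen cells `j'` a SECTION LAW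
`C(j' with m inserted at i) = (1 + (δ_{i,j'} - 1)(-1)^m) · W_i(j') · M · a_m ∏_k a_{j'_k} + O(E)`,
`δ_{i,j'} ∈ [0,2]`, where `W_i = W_{θ⁽ⁱ⁾}` is a Walsh polynomial of the parity vector of `j'`
with `θ⁽ⁱ⁾_∅ = 1`, `|θ⁽ⁱ⁾_S| ≤ 2` (in the application: the law already known for the sub-system
with the `i`-th coordinate deleted).

* `exists_coeff_of_kappa` (normalised form, bulk of side `v ≥ 2`): if every section of `κ ≥ 0`
  on `[1,v]^{n+1}` is within `η ≤ 1` of `λ_{i,j'}(m) W_i(j')`, then `κ` is within `(2n+3)η` of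
  a Walsh polynomial of its parity vector with `θ_∅ = 1`, `|θ_S| ≤ 2` (chain step + mean step +
  positivity step of `ParityWalshCube`);
* `exists_coeff_of_kappa_one` (bulk of side `1`, i.e. `u = 2`): one value `ρ ≥ 0` is matched
  exactly;
* **`exists_walshSum_of_sections`**: the tensor law
  `C(j) = W_θ(j) · M ∏_k a_{j_k} + O(2^{n+3} (a₊/a₋)^{n+1} E)` on all of `[1,u]^{n+1}` with
  `θ_∅ = 1`, `|θ_S| ≤ 2` — small mass `M a₋^{n+1} ≤ E`: Dirac coefficients; large mass:
  normalise by `M ∏ a`, the bulk by the two previous results, the top cells (`∏ a = 0`)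
  directly from the section law at `m = u`.

Everything is elementary real arithmetic over finite index sets and is fully proved; no new
definitions (Walsh polynomials are written as explicit sums `∑_S θ_S ∏_{k∈S} (-1)^{j_k+1}`).

References: E. Bombieri, *The asymptotic sieve*, Rend. Accad. Naz. XL (5) 1/2 (1975/76),
243–269; R. O'Donnell, *Analysis of Boolean Functions* (2014), Ch. 1 [ODonnell2014].
-/

noncomputable section

open Finset
open Literature.Probability.RandomGraphs.LowDegree (walsh)

namespace Literature.NumberTheory.Sieve.ParityWalsh

variable {n : ℕ}

/-! ## Normalised form on the bulk -/

/-- **Normalised assembly on a bulk of side `v ≥ 2`.** Let `κ ≥ 0` on `[1,v]^{n+1}` and suppose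
every coordinate section is parity-affine up to `η ≤ 1`:
`|κ(j' with m inserted at i) - (1 + (δ_{i,j'} - 1)(-1)^m) W_{θ⁽ⁱ⁾}(j')| ≤ η` with `θ⁽ⁱ⁾_∅ = 1`.
Then there are coefficients `θ` with `θ_∅ = 1`, `|θ_S| ≤ 2` and
`|κ(j) - W_θ(j)| ≤ (2n+3) η` on `[1,v]^{n+1}`. Proof: `θ` = Fourier–Walsh coefficients of
`x ↦ κ(r(x))` on the cube of parity patterns (`r(x)_k ∈ {2,1}`), empty coefficient reset to `1`
(it is `1 + O(η)` by the mean step at the coordinate `0`, since `λ(1) + λ(2) = 2` and the cube mean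
of `W_{θ⁽⁰⁾}` is `θ⁽⁰⁾_∅ = 1`); then chain step. [folklore] -/
theorem exists_coeff_of_kappa {v : ℕ} (hv : 2 ≤ v) {κ : (Fin (n + 1) → ℕ) → ℝ}
    (hκ0 : ∀ j, (∀ k, 1 ≤ j k ∧ j k ≤ v) → 0 ≤ κ j)
    {θ' : Fin (n + 1) → Finset (Fin n) → ℝ} (hθ'0 : ∀ i, θ' i ∅ = 1)
    {δ : Fin (n + 1) → (Fin n → ℕ) → ℝ} {η : ℝ} (hη1 : η ≤ 1)
    (hκ : ∀ (i : Fin (n + 1)) (j' : Fin n → ℕ), (∀ k, 1 ≤ j' k ∧ j' k ≤ v) →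
      ∀ m : ℕ, 1 ≤ m → m ≤ v →
        |κ (i.insertNth m j') - (1 + (δ i j' - 1) * (-1 : ℝ) ^ m) *
            ∑ S, θ' i S * ∏ k ∈ S, (-1 : ℝ) ^ (j' k + 1)| ≤ η) :
    ∃ θ : Finset (Fin (n + 1)) → ℝ, θ ∅ = 1 ∧ (∀ S, |θ S| ≤ 2) ∧
      ∀ j : Fin (n + 1) → ℕ, (∀ k, 1 ≤ j k ∧ j k ≤ v) →
        |κ j - ∑ S, θ S * ∏ k ∈ S, (-1 : ℝ) ^ (j k + 1)| ≤ (2 * n + 3) * η := by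
  -- representatives of parity patterns lie in the bulk
  have hrep : ∀ x : Fin (n + 1) → Bool, ∀ k, 1 ≤ (fun k => if x k then (2 : ℕ) else 1) k ∧
      (fun k => if x k then (2 : ℕ) else 1) k ≤ v := fun x k => by
    dsimp only
    split_ifs <;> omega
  have hrep' : ∀ x' : Fin n → Bool, ∀ k, 1 ≤ (fun k => if x' k then (2 : ℕ) else 1) k ∧
      (fun k => if x' k then (2 : ℕ) else 1) k ≤ v := fun x k => by
    dsimp only
    split_ifs <;> omega
  -- the function on the cube
  set f : (Fin (n + 1) → Bool) → ℝ := fun x => κ (fun k => if x k then 2 else 1) with hf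
  have hf0 : ∀ x, 0 ≤ f x := fun x => hκ0 _ (hrep x)
  -- mean step at the coordinate `0`
  have hmean : |∑ x, f x - 2 ^ (n + 1)| ≤ 2 ^ (n + 1) * η := by
    refine abs_sum_cube_sub_le (f := f) 0
      (W := fun x' => ∑ S, θ' 0 S * ∏ k ∈ S, (-1 : ℝ) ^ ((if x' k then (2 : ℕ) else 1) + 1))
      (lam := fun x' b => 1 + (δ 0 (fun k => if x' k then 2 else 1) - 1) *
        (-1 : ℝ) ^ (if b then (2 : ℕ) else 1))
      (fun x' => by norm_num; ring) (fun b x' => ?_) ?_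
    · have h := hκ 0 (fun k => if x' k then 2 else 1) (hrep' x') (if b then 2 else 1)
        (by cases b <;> norm_num) (by cases b <;> simp <;> omega)
      simp only [hf]
      rw [rep_insertNth]
      exact h
    · simp_rw [walshSum_eq_cube, decide_even_rep]
      rw [sum_cube_walshSum, hθ'0 0, mul_one]
  have hmean' : |(∑ x, f x) / 2 ^ (n + 1) - 1| ≤ η := by
    have h2 : (0 : ℝ) < 2 ^ (n + 1) := by positivity
    rw [show (∑ x, f x) / 2 ^ (n + 1) - 1 = (∑ x, f x - 2 ^ (n + 1)) / 2 ^ (n + 1) by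
      field_simp, abs_div, abs_of_pos h2, div_le_iff₀ h2]
    linarith
  -- positivity step
  obtain ⟨θ, hθ0, hθb, hθ⟩ := exists_coeff_of_nonneg hf0 hη1 hmean'
  refine ⟨θ, hθ0, hθb, fun j hj => ?_⟩
  -- chain step
  have hchain := abs_sub_rep_le (κ := κ) hv
    (Λ := fun i j' m => (1 + (δ i j' - 1) * (-1 : ℝ) ^ m) *
      ∑ S, θ' i S * ∏ k ∈ S, (-1 : ℝ) ^ (j' k + 1))
    (fun i j' m m' h => by
      rw [neg_one_pow_eq_pow_mod_two (R := ℝ) (n := m), h, ← neg_one_pow_eq_pow_mod_two])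
    hκ j hj
  have hθj := hθ (fun k => decide (Even (j k)))
  have hrj : (fun k => if decide (Even (j k)) = true then (2 : ℕ) else 1) =
      fun k => if Even (j k) then 2 else 1 := by
    funext k
    simp only [decide_eq_true_eq]
  simp only [hf, hrj] at hθj
  rw [walshSum_eq_cube]
  calc |κ j - ∑ S, θ S * walsh S (fun k => decide (Even (j k)))|
      ≤ |κ j - κ (fun k => if Even (j k) then 2 else 1)| +
          |∑ S, θ S * walsh S (fun k => decide (Even (j k))) -
            κ (fun k => if Even (j k) then 2 else 1)| := by
        rw [abs_sub_comm (∑ S, _) _]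
        exact abs_sub_le _ _ _
    _ ≤ 2 * (n + 1) * η + η := add_le_add hchain hθj
    _ = (2 * n + 3) * η := by ring

/-- **Bulk of side `1` (`u = 2`).** A single value `ρ ≥ 0` with `|ρ - B| ≤ η < 1`,
`|B| ≤ 2^{n+2} - 2`, is matched EXACTLY at the all-odd index by `θ_∅ = 1`,
`θ_S = (ρ - 1)/(2^{n+1} - 1)` (`S ≠ ∅`), and `|θ_S| ≤ 2`. [folklore] -/
theorem exists_coeff_of_kappa_one {ρ B η : ℝ} (hρ : 0 ≤ ρ) (hη : η < 1)
    (hB : |B| ≤ 2 ^ (n + 2) - 2) (h : |ρ - B| ≤ η) :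
    ∃ θ : Finset (Fin (n + 1)) → ℝ, θ ∅ = 1 ∧ (∀ S, |θ S| ≤ 2) ∧
      ∀ j : Fin (n + 1) → ℕ, (∀ k, j k = 1) →
        ∑ S, θ S * ∏ k ∈ S, (-1 : ℝ) ^ (j k + 1) = ρ := by
  have h2n : (2 : ℝ) ≤ 2 ^ (n + 1) := by
    calc (2 : ℝ) = 2 ^ 1 := (pow_one _).symm
      _ ≤ 2 ^ (n + 1) := pow_le_pow_right₀ (by norm_num) (by omega)
  have hD : (0 : ℝ) < 2 ^ (n + 1) - 1 := by linarith
  have hρ1 : |ρ - 1| ≤ 2 * (2 ^ (n + 1) - 1) := by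
    rw [abs_le]
    constructor
    · linarith
    · have h1 := (abs_le.mp h).2
      have h2 := (abs_le.mp hB).2
      rw [pow_succ] at h2
      linarith
  refine ⟨fun S => if S = ∅ then 1 else (ρ - 1) / (2 ^ (n + 1) - 1), if_pos rfl, fun S => ?_,
    fun j hj => ?_⟩
  · dsimp only
    split_ifs
    · rw [abs_one]; norm_num
    · rw [abs_div, abs_of_pos hD, div_le_iff₀ hD]
      exact hρ1
  · have hchar : ∀ S : Finset (Fin (n + 1)), ∏ k ∈ S, (-1 : ℝ) ^ (j k + 1) = 1 := fun S =>
      Finset.prod_eq_one fun k _ => by rw [hj k]; norm_num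
    simp_rw [hchar, mul_one]
    rw [← Finset.add_sum_erase _ _ (Finset.mem_univ ∅), if_pos rfl,
      Finset.sum_congr rfl (g := fun _ => (ρ - 1) / (2 ^ (n + 1) - 1))
        (fun S hS => if_neg (Finset.ne_of_mem_erase hS)),
      Finset.sum_const, Finset.card_erase_of_mem (Finset.mem_univ _), Finset.card_univ,
      Fintype.card_finset, Fintype.card_fin, nsmul_eq_mul, Nat.cast_sub Nat.one_le_two_pow]
    push_cast
    field_simp
    ring

/-! ## The tensor law from the section laws -/

/-- **The tensor law from the section laws.** Let `u ≥ 2`, `C ≥ 0` on `(Fin (n+1) → ℕ)`, weights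
`a_m ≥ 0` with `a_u = 0`, `a₋ ≤ a_m` for `1 ≤ m < u` (`a₋ > 0`), `a_m ≤ a₊`; a mass `M ≥ 0`;
coefficients `θ⁽ⁱ⁾` (`θ⁽ⁱ⁾_∅ = 1`, `|θ⁽ⁱ⁾_S| ≤ 2`) and `δ_{i,j'} ∈ [0,2]`; and the SECTION LAWS
`|C(j' with m inserted at i) - (1 + (δ_{i,j'}-1)(-1)^m) W_{θ⁽ⁱ⁾}(j') M a_m ∏_k a_{j'_k}| ≤ E`
for all `i`, `j' ∈ [1,u]^n`, `m ∈ [1,u]`. Then for some `θ` with `θ_∅ = 1`, `|θ_S| ≤ 2`: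
`|C(j) - W_θ(j) · M ∏_k a_{j_k}| ≤ 2^{n+3} (a₊/a₋)^{n+1} E` for all `j ∈ [1,u]^{n+1}`.
Small mass (`M a₋^{n+1} ≤ E`): `θ = 1_{∅}`. Large mass: normalise `κ = C/(M ∏ a)` on the bulk
`[1,u-1]^{n+1}` (`exists_coeff_of_kappa` for `u ≥ 3`, `exists_coeff_of_kappa_one` for `u = 2`); top
cells (`j_k = u` for some `k`, `∏ a = 0`) from the section law at `m = u`. [folklore] -/
theorem exists_walshSum_of_sections {u : ℕ} (hu : 2 ≤ u)
    {C : (Fin (n + 1) → ℕ) → ℝ} (hC : ∀ j, 0 ≤ C j)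
    {a : ℕ → ℝ} {am aM : ℝ} (ham : 0 < am) (ha0 : ∀ m, 0 ≤ a m) (haM : ∀ m, a m ≤ aM)
    (halo : ∀ m, 1 ≤ m → m < u → am ≤ a m) (hatop : a u = 0)
    {M : ℝ} (hM : 0 ≤ M)
    {θ' : Fin (n + 1) → Finset (Fin n) → ℝ} (hθ'0 : ∀ i, θ' i ∅ = 1)
    (hθ'b : ∀ i S, |θ' i S| ≤ 2)
    {δ : Fin (n + 1) → (Fin n → ℕ) → ℝ} (hδ : ∀ i j', 0 ≤ δ i j' ∧ δ i j' ≤ 2) {E : ℝ}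
    (hsec : ∀ (i : Fin (n + 1)) (j' : Fin n → ℕ), (∀ k, 1 ≤ j' k ∧ j' k ≤ u) →
      ∀ m : ℕ, 1 ≤ m → m ≤ u →
        |C (i.insertNth m j') - (1 + (δ i j' - 1) * (-1 : ℝ) ^ m) *
            (∑ S, θ' i S * ∏ k ∈ S, (-1 : ℝ) ^ (j' k + 1)) * M * (a m * ∏ k, a (j' k))| ≤ E) :
    ∃ θ : Finset (Fin (n + 1)) → ℝ, θ ∅ = 1 ∧ (∀ S, |θ S| ≤ 2) ∧
      ∀ j : Fin (n + 1) → ℕ, (∀ k, 1 ≤ j k ∧ j k ≤ u) →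
        |C j - (∑ S, θ S * ∏ k ∈ S, (-1 : ℝ) ^ (j k + 1)) * (M * ∏ k, a (j k))|
          ≤ 2 ^ (n + 3) * (aM / am) ^ (n + 1) * E := by
  -- shorthand and a priori bounds
  set W : Fin (n + 1) → (Fin n → ℕ) → ℝ :=
    fun i j' => ∑ S, θ' i S * ∏ k ∈ S, (-1 : ℝ) ^ (j' k + 1) with hW
  set lam : Fin (n + 1) → (Fin n → ℕ) → ℕ → ℝ :=
    fun i j' m => 1 + (δ i j' - 1) * (-1 : ℝ) ^ m with hlam
  set P : (Fin (n + 1) → ℕ) → ℝ := fun j => ∏ k, a (j k) with hP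
  have hlam_abs : ∀ i j' m, |lam i j' m| ≤ 2 := fun i j' m => by
    simp only [hlam]
    obtain ⟨h0, h2⟩ := hδ i j'
    rcases neg_one_pow_eq_or ℝ m with h | h <;> rw [h, abs_le] <;> constructor <;> linarith
  have hW_abs : ∀ i j', |W i j'| ≤ 2 ^ (n + 1) - 1 := fun i j' =>
    abs_walshSum_le (θ' i) (hθ'0 i) (hθ'b i) j'
  have hE0 : 0 ≤ E :=
    (abs_nonneg _).trans (hsec 0 (fun _ => 1) (fun _ => ⟨le_rfl, by omega⟩) 1 le_rfl (by omega))
  have haM1 : am ≤ aM := (halo 1 le_rfl (by omega)).trans (haM 1)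
  have haM0 : 0 ≤ aM := ham.le.trans haM1
  have hρ1 : 1 ≤ aM / am := (one_le_div ham).mpr haM1
  have hρn : 1 ≤ (aM / am) ^ (n + 1) := one_le_pow₀ hρ1
  have hP0 : ∀ j, 0 ≤ P j := fun j => Finset.prod_nonneg fun k _ => ha0 _
  have hPle : ∀ j, P j ≤ aM ^ (n + 1) := fun j => by
    calc P j ≤ ∏ _k : Fin (n + 1), aM := Finset.prod_le_prod (fun k _ => ha0 _) fun k _ => haM _
      _ = aM ^ (n + 1) := by rw [Finset.prod_const, Finset.card_univ, Fintype.card_fin]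
  have hPge : ∀ j : Fin (n + 1) → ℕ, (∀ k, 1 ≤ j k ∧ j k ≤ u - 1) → am ^ (n + 1) ≤ P j := by
    intro j hj
    calc am ^ (n + 1) = ∏ _k : Fin (n + 1), am := by
          rw [Finset.prod_const, Finset.card_univ, Fintype.card_fin]
      _ ≤ P j := Finset.prod_le_prod (fun k _ => ham.le) fun k _ =>
          halo _ (hj k).1 (by have := (hj k).2; omega)
  have hbound1 : E ≤ 2 ^ (n + 3) * (aM / am) ^ (n + 1) * E := by
    have : (1 : ℝ) ≤ 2 ^ (n + 3) * (aM / am) ^ (n + 1) :=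
      one_le_mul_of_one_le_of_one_le (one_le_pow₀ (by norm_num)) hρn
    nlinarith
  -- the section law at a full index `j`, read through the coordinate `i`
  have hsecj : ∀ j : Fin (n + 1) → ℕ, (∀ k, 1 ≤ j k ∧ j k ≤ u) → ∀ i,
      |C j - lam i (i.removeNth j) (j i) * W i (i.removeNth j) * M * P j| ≤ E := by
    intro j hj i
    have h := hsec i (i.removeNth j) (fun k => hj _) (j i) (hj i).1 (hj i).2
    rw [Fin.insertNth_self_removeNth] at h
    have hPj : a (j i) * ∏ k, a (i.removeNth j k) = P j := by
      simp only [hP, Fin.removeNth_apply]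
      rw [Fin.prod_univ_succAbove (fun k => a (j k)) i]
    rw [hPj] at h
    exact h
  by_cases hcase : M * am ^ (n + 1) ≤ E
  · -- SMALL MASS: Dirac coefficients
    refine ⟨fun S => if S = ∅ then 1 else 0, if_pos rfl,
      fun S => by dsimp only; split_ifs <;> norm_num, fun j hj => ?_⟩
    rw [walshSum_dirac, one_mul]
    have h1 := hsecj j hj 0
    have hMP : M * P j ≤ (aM / am) ^ (n + 1) * E := by
      calc M * P j ≤ M * aM ^ (n + 1) := mul_le_mul_of_nonneg_left (hPle j) hM
        _ = M * am ^ (n + 1) * (aM / am) ^ (n + 1) := by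
            rw [div_pow, mul_assoc, mul_div_cancel₀ _ (pow_ne_zero _ ham.ne')]
        _ ≤ E * (aM / am) ^ (n + 1) := mul_le_mul_of_nonneg_right hcase (by positivity)
        _ = (aM / am) ^ (n + 1) * E := mul_comm _ _
    have hcoef : |lam 0 (Fin.removeNth 0 j) (j 0) * W 0 (Fin.removeNth 0 j) - 1| ≤
        2 ^ (n + 2) - 1 := by
      have hprod : |lam 0 (Fin.removeNth 0 j) (j 0) * W 0 (Fin.removeNth 0 j)| ≤
          2 * (2 ^ (n + 1) - 1) := by
        rw [abs_mul]
        exact mul_le_mul (hlam_abs _ _ _) (hW_abs _ _) (abs_nonneg _) (by norm_num)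
      calc |lam 0 (Fin.removeNth 0 j) (j 0) * W 0 (Fin.removeNth 0 j) - 1|
          ≤ |lam 0 (Fin.removeNth 0 j) (j 0) * W 0 (Fin.removeNth 0 j)| + |(1 : ℝ)| := abs_sub _ _
        _ ≤ 2 * (2 ^ (n + 1) - 1) + 1 := add_le_add hprod (by rw [abs_one])
        _ = 2 ^ (n + 2) - 1 := by ring
    have hMP0 : 0 ≤ M * P j := mul_nonneg hM (hP0 j)
    calc |C j - M * P j|
        = |(C j - lam 0 (Fin.removeNth 0 j) (j 0) * W 0 (Fin.removeNth 0 j) * M * P j) +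
            (lam 0 (Fin.removeNth 0 j) (j 0) * W 0 (Fin.removeNth 0 j) - 1) * (M * P j)| := by
          ring_nf
      _ ≤ |C j - lam 0 (Fin.removeNth 0 j) (j 0) * W 0 (Fin.removeNth 0 j) * M * P j| +
            |lam 0 (Fin.removeNth 0 j) (j 0) * W 0 (Fin.removeNth 0 j) - 1| * (M * P j) := by
          refine (abs_add_le _ _).trans (add_le_add le_rfl ?_)
          rw [abs_mul, abs_of_nonneg hMP0]
      _ ≤ E + (2 ^ (n + 2) - 1) * ((aM / am) ^ (n + 1) * E) :=
          add_le_add h1 (mul_le_mul hcoef hMP hMP0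
            (by linarith [one_le_pow₀ (M₀ := ℝ) (a := 2) one_le_two (n := n + 2)]))
      _ ≤ 2 ^ (n + 3) * (aM / am) ^ (n + 1) * E := by
          have h4 : E ≤ (aM / am) ^ (n + 1) * E := by nlinarith
          nlinarith [pow_succ (2 : ℝ) (n + 2),
            mul_nonneg (by positivity : (0 : ℝ) ≤ (aM / am) ^ (n + 1)) hE0]
  · -- LARGE MASS: normalise on the bulk
    push Not at hcase
    have hMpos : 0 < M := by
      rcases hM.lt_or_eq with h | h
      · exact h
      · rw [← h, zero_mul] at hcase; linarith
    have hMa : 0 < M * am ^ (n + 1) := by positivity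
    set η : ℝ := E / (M * am ^ (n + 1)) with hη
    have hη0 : 0 ≤ η := div_nonneg hE0 hMa.le
    have hη1 : η < 1 := (div_lt_one hMa).mpr hcase
    set κ : (Fin (n + 1) → ℕ) → ℝ := fun j => C j / (M * P j) with hκ
    have hκ0 : ∀ j, 0 ≤ κ j := fun j => div_nonneg (hC j) (mul_nonneg hM (hP0 j))
    -- the section law in normalised form on the bulk
    have hκsec : ∀ (i : Fin (n + 1)) (j' : Fin n → ℕ), (∀ k, 1 ≤ j' k ∧ j' k ≤ u - 1) →
        ∀ m : ℕ, 1 ≤ m → m ≤ u - 1 → |κ (i.insertNth m j') - lam i j' m * W i j'| ≤ η := by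
      intro i j' hj' m hm1 hmu
      have hj'u : ∀ k, 1 ≤ j' k ∧ j' k ≤ u := fun k => ⟨(hj' k).1, (hj' k).2.trans (Nat.sub_le u 1)⟩
      have h := hsec i j' hj'u m hm1 (hmu.trans (Nat.sub_le u 1))
      have hPins : P (i.insertNth m j') = a m * ∏ k, a (j' k) := by
        simp only [hP]
        rw [Fin.prod_univ_succAbove _ i]
        simp only [Fin.insertNth_apply_same, Fin.insertNth_apply_succAbove]
      have hins : ∀ k, 1 ≤ (i.insertNth m j' : Fin (n + 1) → ℕ) k ∧
          (i.insertNth m j' : Fin (n + 1) → ℕ) k ≤ u - 1 := fun k => by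
        refine Fin.succAboveCases i ?_ (fun k => ?_) k
        · simp only [Fin.insertNth_apply_same]; exact ⟨hm1, hmu⟩
        · simp only [Fin.insertNth_apply_succAbove]; exact hj' k
      have hPlo : am ^ (n + 1) ≤ P (i.insertNth m j') := hPge _ hins
      have hMP : 0 < M * P (i.insertNth m j') := mul_pos hMpos (lt_of_lt_of_le (by positivity) hPlo)
      have hPne : P (i.insertNth m j') ≠ 0 := fun h => by
        rw [h, mul_zero] at hMP; exact lt_irrefl _ hMP
      have hMne : M ≠ 0 := hMpos.ne'
      have hrew : κ (i.insertNth m j') - lam i j' m * W i j' =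
          (C (i.insertNth m j') - lam i j' m * W i j' * M * (a m * ∏ k, a (j' k))) /
            (M * P (i.insertNth m j')) := by
        simp only [hκ]
        rw [← hPins]
        field_simp
      rw [hrew, abs_div, abs_of_pos hMP]
      calc |C (i.insertNth m j') - lam i j' m * W i j' * M * (a m * ∏ k, a (j' k))| /
            (M * P (i.insertNth m j'))
          ≤ E / (M * P (i.insertNth m j')) := div_le_div_of_nonneg_right h hMP.le
        _ ≤ E / (M * am ^ (n + 1)) :=
            div_le_div_of_nonneg_left hE0 hMa (mul_le_mul_of_nonneg_left hPlo hM)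
    -- Walsh coefficients on the bulk
    obtain ⟨θ, hθ0, hθb, hθ⟩ : ∃ θ : Finset (Fin (n + 1)) → ℝ, θ ∅ = 1 ∧ (∀ S, |θ S| ≤ 2) ∧
        ∀ j : Fin (n + 1) → ℕ, (∀ k, 1 ≤ j k ∧ j k ≤ u - 1) →
          |κ j - ∑ S, θ S * ∏ k ∈ S, (-1 : ℝ) ^ (j k + 1)| ≤ (2 * n + 3) * η := by
      rcases (show u = 2 ∨ 3 ≤ u by omega) with rfl | hu3
      · -- bulk of side 1: the all-odd index only
        have h1 := hκsec 0 (fun _ => 1) (fun _ => ⟨le_rfl, le_rfl⟩) 1 le_rfl le_rfl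
        have hone : (Fin.insertNth 0 1 (fun _ => 1) : Fin (n + 1) → ℕ) = fun _ => 1 := by
          funext k
          refine Fin.cases ?_ (fun k => ?_) k
          · exact Fin.insertNth_apply_same 0 1 (fun _ => 1)
          · exact Fin.insertNth_apply_succAbove 0 1 (fun _ => 1) k
        rw [hone] at h1
        have hB : |lam 0 (fun _ => 1) 1 * W 0 fun _ => 1| ≤ 2 ^ (n + 2) - 2 := by
          rw [abs_mul]
          calc |lam 0 (fun _ => 1) 1| * |W 0 fun _ => 1| ≤ 2 * (2 ^ (n + 1) - 1) :=
                mul_le_mul (hlam_abs _ _ _) (hW_abs _ _) (abs_nonneg _) (by norm_num)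
            _ = 2 ^ (n + 2) - 2 := by ring
        obtain ⟨θ, hθ0, hθb, hθ1⟩ := exists_coeff_of_kappa_one (hκ0 _) hη1 hB h1
        refine ⟨θ, hθ0, hθb, fun j hj => ?_⟩
        have hj1 : j = fun _ => 1 := funext fun k => by have := hj k; omega
        rw [hθ1 j (fun k => by rw [hj1]), hj1, sub_self, abs_zero]
        positivity
      · exact exists_coeff_of_kappa (v := u - 1) (by omega) (fun j _ => hκ0 j) hθ'0 hη1.le hκsec
    refine ⟨θ, hθ0, hθb, fun j hj => ?_⟩
    by_cases htop : ∃ k, j k = u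
    · -- TOP CELL
      obtain ⟨k, hk⟩ := htop
      have hPj : P j = 0 := Finset.prod_eq_zero (Finset.mem_univ k) (by rw [hk, hatop])
      have h := hsecj j hj k
      rw [hPj, mul_zero, sub_zero] at h
      rw [show M * ∏ k, a (j k) = M * P j from rfl, hPj, mul_zero, mul_zero, sub_zero]
      exact h.trans hbound1
    · -- BULK CELL
      push Not at htop
      have hjb : ∀ k, 1 ≤ j k ∧ j k ≤ u - 1 := fun k =>
        ⟨(hj k).1, by have h1 := (hj k).2; have h2 := htop k; omega⟩
      have h := hθ j hjb
      have hMP : 0 < M * P j := mul_pos hMpos (lt_of_lt_of_le (by positivity) (hPge j hjb))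
      have hPne : ∏ k, a (j k) ≠ 0 := fun h0 => by
        rw [show M * P j = M * ∏ k, a (j k) from rfl, h0, mul_zero] at hMP; exact lt_irrefl _ hMP
      have hMne : M ≠ 0 := hMpos.ne'
      have hrew : C j - (∑ S, θ S * ∏ k ∈ S, (-1 : ℝ) ^ (j k + 1)) * (M * ∏ k, a (j k)) =
          (κ j - ∑ S, θ S * ∏ k ∈ S, (-1 : ℝ) ^ (j k + 1)) * (M * P j) := by
        simp only [hκ, hP]
        field_simp
      rw [hrew, abs_mul, abs_of_pos hMP]
      calc |κ j - ∑ S, θ S * ∏ k ∈ S, (-1 : ℝ) ^ (j k + 1)| * (M * P j)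
          ≤ (2 * n + 3) * η * (M * P j) := mul_le_mul_of_nonneg_right h hMP.le
        _ = (2 * n + 3) * (E * (P j / am ^ (n + 1))) := by
            simp only [hη]
            field_simp
        _ ≤ (2 * n + 3) * (E * (aM / am) ^ (n + 1)) := by
            refine mul_le_mul_of_nonneg_left (mul_le_mul_of_nonneg_left ?_ hE0) (by positivity)
            rw [div_pow]
            exact div_le_div_of_nonneg_right (hPle j) (by positivity)
        _ ≤ 2 ^ (n + 3) * (E * (aM / am) ^ (n + 1)) :=
            mul_le_mul_of_nonneg_right (two_mul_add_three_le_two_pow n) (by positivity)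
        _ = 2 ^ (n + 3) * (aM / am) ^ (n + 1) * E := by ring

end Literature.NumberTheory.Sieve.ParityWalsh

end
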